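import Summits.AnomalousDissipation.AnomalousDissipation.Theorems.SolenoidalFractalHomogenisationLagrangianCarrierConstructionTowerContinuity
import Summits.AnomalousDissipation.AnomalousDissipation.Theorems.SolenoidalFractalHomogenisationLagrangianCarrierConstructionTowerStepC
import HarnessLib

/-!
# K3L `LagrangianCarrierConstruction` (stmt-AnomalousDissipation-24913), line `birth`, stub `stub_flowsL`:
# joint continuity of the inserted levels and of the displacements (helper; `--supports stmt-AnomalousDissipation-24913`)

Summits-side helper file (everything proved; no definitions, no named facts). Clauses (L1) and (F1a) of `LevelRegular` for ONE level of the
Lagrangian tower, with the level data passed as hypotheses (no tower construction here):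
* `continuous_disp_of_slabs` — the displacement `(t, x) ↦ A t ((A s)⁻¹ (repr x)) − repr x` is jointly continuous on `ℝ × 𝕋³` (joint
  continuity of the lifted flow from its one-sided `C¹` slabs, lattice periodicity, descent along `id × proj`);
* `continuous_inserted_level` — the inserted level `(t, x) ↦ D(A t ∘ A w⁻¹)(A w (A t⁻¹ repr x)) (v t (…))`, `w = ⌊t/R⌋R`, is jointly continuous
  PROVIDED the Eulerian field vanishes at the window boundaries `jR` (which (W1) guarantees: windows are whole fine periods and the ramped word
  vanishes at period boundaries): on each CLOSED window the inserted level is the fixed-frame formula of that window (both vanish at the right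
  end), and the fixed-frame formulas are jointly continuous (`…TowerContinuity`).
NOT a proof of anomalous dissipation (F-D1 is a frontier formal rung).
-/

set_option linter.dupNamespace false

noncomputable section

namespace Summit.AnomalousDissipation.AnomalousDissipation.Theorems.SolenoidalFractalHomogenisation.LagrangianCarrierConstruction

open Set Function Filter Topology Metric
open scoped NNReal
open Literature.Analysis.ODE Literature.Analysis.FunctionSpaces

variable {d : Type*} [Fintype d] [DecidableEq d]

/-- **(F1a) The displacements are jointly continuous.** [folklore] -/
theorem continuous_disp_of_slabs (A : ℝ → EuclideanSpace ℝ d ≃ EuclideanSpace ℝ d)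
    (h1 : ∀ t z (k : d → ℤ), A t (z + Torus.latticeVec k) = A t z + Torus.latticeVec k)
    (h3 : ∀ r, ∃ ε > 0, ContDiffOn ℝ 1 (fun p : ℝ × EuclideanSpace ℝ d => A p.1 p.2) (Icc r (r + ε) ×ˢ univ) ∧
      ContDiffOn ℝ 1 (fun p : ℝ × EuclideanSpace ℝ d => A p.1 p.2) (Icc (r - ε) r ×ˢ univ))
    (s : ℝ) (hAs : ContDiff ℝ 1 (A s).symm) (disp : ℝ → UnitAddTorus d → EuclideanSpace ℝ d)
    (hdisp : ∀ t x, disp t x = A t ((A s).symm (Torus.repr x)) - Torus.repr x) :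
    Continuous fun p : ℝ × UnitAddTorus d => disp p.1 p.2 := by
  have hc := continuous_uncurry_of_slabs (Φ := fun t => ⇑(A t)) h3
  have hG : Continuous fun p : ℝ × EuclideanSpace ℝ d => A p.1 ((A s).symm p.2) - p.2 := by
    refine Continuous.sub ?_ continuous_snd
    exact hc.comp (continuous_fst.prodMk (hAs.continuous.comp continuous_snd))
  have hper : ∀ t z (k : d → ℤ), A t ((A s).symm (z + Torus.latticeVec k)) - (z + Torus.latticeVec k) = A t ((A s).symm z) - z := by
    intro t z k; rw [equivariant_symm (h1 s), h1]; abel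
  have h := continuous_uncurry_repr (G := fun t z => A t ((A s).symm z) - z) hG hper
  refine h.congr fun p => ?_
  simp only [hdisp]

/-- **(L1) The inserted level is jointly continuous when the Eulerian field vanishes at the window boundaries.** [folklore] -/
theorem continuous_inserted_level (A : ℝ → EuclideanSpace ℝ d ≃ EuclideanSpace ℝ d)
    (h1 : ∀ t z (k : d → ℤ), A t (z + Torus.latticeVec k) = A t z + Torus.latticeVec k)
    (h3 : ∀ r, ∃ ε > 0, ContDiffOn ℝ 1 (fun p : ℝ × EuclideanSpace ℝ d => A p.1 p.2) (Icc r (r + ε) ×ˢ univ) ∧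
      ContDiffOn ℝ 1 (fun p : ℝ × EuclideanSpace ℝ d => A p.1 p.2) (Icc (r - ε) r ×ˢ univ))
    (h3' : ∀ r, ∃ ε > 0, ContDiffOn ℝ 1 (fun p : ℝ × EuclideanSpace ℝ d => (A p.1).symm p.2) (Icc r (r + ε) ×ˢ univ) ∧
      ContDiffOn ℝ 1 (fun p : ℝ × EuclideanSpace ℝ d => (A p.1).symm p.2) (Icc (r - ε) r ×ˢ univ))
    (v : ℝ → EuclideanSpace ℝ d → EuclideanSpace ℝ d) (hvc : Continuous (uncurry v))
    (hvper : ∀ t z (k : d → ℤ), v t (z + Torus.latticeVec k) = v t z)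
    {R : ℝ} (hR : 0 < R) (hvan : ∀ (j : ℤ) z, v ((j : ℝ) * R) z = 0)
    (b : ℝ → UnitAddTorus d → EuclideanSpace ℝ d)
    (hb : ∀ t x, b t x = fderiv ℝ (fun y => A t ((A ((⌊t / R⌋ : ℝ) * R)).symm y))
      (A ((⌊t / R⌋ : ℝ) * R) ((A t).symm (Torus.repr x))) (v t (A ((⌊t / R⌋ : ℝ) * R) ((A t).symm (Torus.repr x))))) :
    Continuous (uncurry b) := by
  -- regularity of the frame
  have hA1 : ∀ t, ContDiff ℝ 1 (A t) ∧ ContDiff ℝ 1 (A t).symm := fun t => by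
    obtain ⟨ε, hε, hR1, -⟩ := h3 t
    obtain ⟨ε', hε', hR2, -⟩ := h3' t
    exact ⟨hR1.comp_contDiff (contDiff_const.prodMk contDiff_id) fun _ => ⟨⟨le_rfl, by linarith⟩, mem_univ _⟩,
      hR2.comp_contDiff (contDiff_const.prodMk contDiff_id) fun _ => ⟨⟨le_rfl, by linarith⟩, mem_univ _⟩⟩
  have hAsym : Continuous fun p : ℝ × EuclideanSpace ℝ d => (A p.1).symm p.2 :=
    continuous_uncurry_of_slabs (Φ := fun t => ⇑(A t).symm) h3'
  have hDA : Continuous fun p : ℝ × EuclideanSpace ℝ d => fderiv ℝ (A p.1) p.2 :=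
    continuous_fderiv_slice_of_slabs (Φ := fun t => ⇑(A t)) h3
  -- the fixed-frame formulas are jointly continuous
  have hF : ∀ s : ℝ, Continuous fun p : ℝ × EuclideanSpace ℝ d => fderiv ℝ (fun y => A p.1 ((A s).symm y))
      (A s ((A p.1).symm p.2)) (v p.1 (A s ((A p.1).symm p.2))) := fun s =>
    continuous_inserted_fixed_frame A v s hAsym hDA (fun t => (hA1 t).1) (hA1 s).2 hvc
  -- the lifted inserted level: on each CLOSED window it is the window's fixed-frame formula
  have hG : Continuous fun p : ℝ × EuclideanSpace ℝ d => fderiv ℝ (fun y => A p.1 ((A ((⌊p.1 / R⌋ : ℝ) * R)).symm y))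
      (A ((⌊p.1 / R⌋ : ℝ) * R) ((A p.1).symm p.2)) (v p.1 (A ((⌊p.1 / R⌋ : ℝ) * R) ((A p.1).symm p.2))) := by
    have key : ∀ (j : ℤ) (p : ℝ × EuclideanSpace ℝ d), p.1 ∈ Icc ((j : ℝ) * R) (((j : ℝ) + 1) * R) →
        fderiv ℝ (fun y => A p.1 ((A ((⌊p.1 / R⌋ : ℝ) * R)).symm y)) (A ((⌊p.1 / R⌋ : ℝ) * R) ((A p.1).symm p.2))
          (v p.1 (A ((⌊p.1 / R⌋ : ℝ) * R) ((A p.1).symm p.2))) =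
        fderiv ℝ (fun y => A p.1 ((A ((j : ℝ) * R)).symm y)) (A ((j : ℝ) * R) ((A p.1).symm p.2))
          (v p.1 (A ((j : ℝ) * R) ((A p.1).symm p.2))) := by
      intro j p hp
      rcases lt_or_eq_of_le hp.2 with hlt | heq
      · rw [floor_eq_of_mem_Ico hR ⟨hp.1, hlt⟩]
      · -- right end of the window: the field vanishes, both sides are `0`
        have hv0 : ∀ z, v p.1 z = 0 := fun z => by
          rw [heq, show ((j : ℝ) + 1) * R = ((j + 1 : ℤ) : ℝ) * R by push_cast; ring]; exact hvan _ z
        simp only [hv0, map_zero]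
    refine continuous_iff_continuousAt.2 fun p => ?_
    obtain ⟨ε₁, hε₁, hs₁⟩ := exists_Icc_right_subset_window hR p.1
    obtain ⟨ε₂, hε₂, hs₂⟩ := exists_Icc_left_subset_window hR p.1
    have hcR : ContinuousOn (fun p : ℝ × EuclideanSpace ℝ d => fderiv ℝ (fun y => A p.1 ((A ((⌊p.1 / R⌋ : ℝ) * R)).symm y))
        (A ((⌊p.1 / R⌋ : ℝ) * R) ((A p.1).symm p.2)) (v p.1 (A ((⌊p.1 / R⌋ : ℝ) * R) ((A p.1).symm p.2))))
        (Icc p.1 (p.1 + ε₁) ×ˢ univ) :=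
      (hF _).continuousOn.congr fun q hq => key ⌊p.1 / R⌋ q (hs₁ hq.1)
    have hcL : ContinuousOn (fun p : ℝ × EuclideanSpace ℝ d => fderiv ℝ (fun y => A p.1 ((A ((⌊p.1 / R⌋ : ℝ) * R)).symm y))
        (A ((⌊p.1 / R⌋ : ℝ) * R) ((A p.1).symm p.2)) (v p.1 (A ((⌊p.1 / R⌋ : ℝ) * R) ((A p.1).symm p.2))))
        (Icc (p.1 - ε₂) p.1 ×ˢ univ) := by
      refine (hF (((⌈p.1 / R⌉ - 1 : ℤ) : ℝ) * R)).continuousOn.congr fun q hq => ?_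
      have hq' := hs₂ hq.1
      have e : ((((⌈p.1 / R⌉ - 1 : ℤ) : ℝ) + 1) * R) = ((((⌈p.1 / R⌉ - 1 : ℤ)) : ℝ) + 1) * R := rfl
      exact key (⌈p.1 / R⌉ - 1) q (by exact_mod_cast hq')
    have hU := hcL.union_of_isClosed hcR (isClosed_Icc.prod isClosed_univ) (isClosed_Icc.prod isClosed_univ)
    refine hU.continuousAt (Filter.mem_of_superset (prod_mem_nhds (Icc_mem_nhds (show p.1 - ε₂ < p.1 by linarith)
      (show p.1 < p.1 + ε₁ by linarith)) univ_mem) ?_)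
    rintro q ⟨hq, -⟩
    rcases le_or_gt q.1 p.1 with h | h
    · exact Or.inl ⟨⟨hq.1, h⟩, mem_univ _⟩
    · exact Or.inr ⟨⟨h.le, hq.2⟩, mem_univ _⟩
  -- descent to the torus
  have hper : ∀ t z (k : d → ℤ), fderiv ℝ (fun y => A t ((A ((⌊t / R⌋ : ℝ) * R)).symm y))
      (A ((⌊t / R⌋ : ℝ) * R) ((A t).symm (z + Torus.latticeVec k))) (v t (A ((⌊t / R⌋ : ℝ) * R) ((A t).symm (z + Torus.latticeVec k)))) =
      fderiv ℝ (fun y => A t ((A ((⌊t / R⌋ : ℝ) * R)).symm y)) (A ((⌊t / R⌋ : ℝ) * R) ((A t).symm z))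
        (v t (A ((⌊t / R⌋ : ℝ) * R) ((A t).symm z))) := fun t z k => inserted_add_latticeVec A v t _ h1 hvper z k
  have h := continuous_uncurry_repr (G := fun t z => fderiv ℝ (fun y => A t ((A ((⌊t / R⌋ : ℝ) * R)).symm y))
      (A ((⌊t / R⌋ : ℝ) * R) ((A t).symm z)) (v t (A ((⌊t / R⌋ : ℝ) * R) ((A t).symm z)))) hG hper
  refine h.congr fun p => ?_
  simp only [uncurry, hb]

end Summit.AnomalousDissipation.AnomalousDissipation.Theorems.SolenoidalFractalHomogenisation.LagrangianCarrierConstruction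

end
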